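import Literature.MathematicalPhysics.QuantumFieldTheory.LatticeGaugeStaticPotentialLimitProofs
import Literature.MathematicalPhysics.QuantumFieldTheory.LatticeGaugeStringTensionProofs
import HarnessLib

/-!
# Gram inequalities and the Seiler–Bachas plaquette lower bound for Wilson loops in an
# arbitrary representation, on the even torus

The files `ConstructiveQFTWave0WilsonLoopRPProofs` (torus Gram inequalities) and
`StaticPotentialConcavity` (Bachas 1986 / Seiler 1978 for infinite-volume limit states) treat the
rectangular Wilson loops `W_γ = (1/N) Re tr ρ(U_γ)` in the SAME representation `ρ` as the Wilson
action `β ∑ₚ Re tr ρ(U_p)`. This file records the same reflection-positivity consequences for the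
loops `W^π_γ = (1/M) Re tr π(U_γ)` in an ARBITRARY continuous finite-dimensional representation
`π : G →* M_M(ℂ)` of the compact gauge group `G` (e.g. a centre-charged `π` under a faithful action
`ρ`), under the torus Wilson state `⟨·⟩_{Λ_L,β}` of `ρ`, `L` even, `β ≥ 0`, time direction `0`,
spatial direction `j ≠ 0`, loops `wilsonLoop π 0 0 j h R` (`h` steps in the time direction, `R`
steps in direction `j`), `W(h) := ⟨W^π_{h × R}⟩_{Λ_L,β}`:

* `WilsonLoopRP.gram_wilsonLoopRep_nonneg_link / _site` and the instance-free
  `gram_wilsonLoopRep_nonneg_odd / _even`: the Hankel matrices `[W(s+t+1)]_{s,t}` (heights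
  `s + 1 ≤ L/2`) and `[W(s+t)]_{s,t}` (heights `s ≤ L/2`) are positive semi-definite — Osterwalder–
  Seiler reflection positivity of the torus Wilson measure in the hyperplanes between time slices
  (`wilsonExpectation_nonneg_of_covariant`) and through sites (`wilsonExpectation_siteReflectionPositive`),
  which are statements about the MEASURE and hold for every bounded observable of the positive
  half; the loop's representation only enters the staple algebra
  (`WilsonLoopRP.trace_rectangleHolonomy_translate`, applied to `π`).
  [cite: SeilerLNP1982, §2 (reflection positivity and the transfer matrix)]
* `wilsonExpectation_wilsonLoopRep_zero / _nonneg / _sq_le`: `W(0) = 1`, `W(h) ≥ 0` (`h + 1 ≤ L`),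
  `W(h+1)² ≤ W(h) W(h+2)` (`h + 3 ≤ L`) — Bachas' inequality (8) in the time direction.
  [cite: Bachas1986, eq. (8)]
* `pow_wilsonExpectation_wilsonLoopRep_le`: `W(1)^h ≤ W(h)` for `h + 1 ≤ L` — a non-negative
  log-convex sequence with `W(0) = 1` dominates the geometric sequence through `W(1)` (zeros
  allowed: if `W(1) = 0` there is nothing to prove, otherwise all `W(h) > 0`).
* `plaquette_pow_le_wilsonExpectation_wilsonLoopRep` (the `(0,1)` plane): for `h + 1 ≤ L`,
  `R + 1 ≤ L`, `⟨W^π_{1×1}⟩^{h R} ≤ ⟨W^π_{h×R}⟩_{Λ_L,β}` — every rectangular `π`-loop expectation on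
  the even torus is bounded BELOW by the mean `π`-plaquette raised to the area. This is the torus,
  general-representation form of Seiler's theorem "the (suitably defined) potential between color
  charges cannot rise faster than linearly with distance" [cite: Seiler1978, abstract] in the
  loop-level form `W(1,1)^{RT} ≤ W(R,T)` of `StaticPotential.plaquette_pow_le_rectExpectation`;
  the second direction uses the coordinate-exchange symmetry of the torus Wilson state
  (`StringTension.wilsonExpectation_comp_swap`). Consequence used by finite-torus area-law
  formats: an area law `⟨W^π_{h×R}⟩ ≤ C^{2(h+R)} e^{-s h R}` on all large even tori forces
  `s ≤ -log ⟨W^π_{1×1}⟩` whenever the mean `π`-plaquette is positive.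

Scope: even torus side `L` (the odd torus needs the mixed reflection of `TorusOddLoops` and is not
treated); the two-direction bound is stated in the `(0,1)` plane (the tree's swap symmetry is
`0 ↔ 1`); no positivity or size of `⟨W^π_{1×1}⟩` is asserted (that is a strong-coupling-expansion
statement, not a reflection-positivity one). Everything here is proved; no definitions, no named
facts.

## References

* E. Seiler, *Upper bound on the color-confining potential*, Phys. Rev. D 18 (1978) 482–483.
* C. Bachas, *Concavity of the quarkonium potential*, Phys. Rev. D 33 (1986) 2723–2725, eq. (8).
* E. Seiler, *Gauge Theories as a Problem of Constructive Quantum Field Theory and Statistical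
  Mechanics*, LNP 159 (1982), §2; K. Osterwalder, E. Seiler, Ann. Phys. 110 (1978) 440, §2.
-/

open MeasureTheory Finset Complex
open scoped ComplexOrder ENNReal ComplexConjugate

namespace Literature.MathematicalPhysics.QuantumFieldTheory

noncomputable section

namespace WilsonLoopRP

open WilsonRP WilsonSiteRP
open Literature.RepresentationTheory.CompactGroups

/-! ## Gram positivity on the even torus for loops in the representation `π` -/

section Gram

variable {d L N M : ℕ} [NeZero d] [NeZero L] [Fact (1 < L)]
variable {G : Type*} [Group G] [TopologicalSpace G] [IsTopologicalGroup G] [CompactSpace G]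
  [MeasurableSpace G] [BorelSpace G]
variable (ρ : G →* Matrix (Fin N) (Fin N) ℂ) (π : G →* Matrix (Fin M) (Fin M) ℂ)

omit [NeZero d] [NeZero L] [Fact (1 < L)] in
/-- Rearranging a Gram double sum of matrix entries. [folklore] -/
private theorem sum_sum_mul_sum_sum' {α : Type*} [Fintype α] (S : Finset ℕ) (f g : ℕ → α → α → ℂ) :
    (∑ i : α, ∑ l : α, (∑ a ∈ S, f a i l) * ∑ b ∈ S, g b i l) =
      ∑ a ∈ S, ∑ b ∈ S, ∑ i : α, ∑ l : α, f a i l * g b i l := by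
  simp only [Finset.sum_mul_sum]
  calc ∑ i : α, ∑ l : α, ∑ a ∈ S, ∑ b ∈ S, f a i l * g b i l
      = ∑ i : α, ∑ a ∈ S, ∑ l : α, ∑ b ∈ S, f a i l * g b i l :=
        Finset.sum_congr rfl fun i _ => Finset.sum_comm
    _ = ∑ a ∈ S, ∑ i : α, ∑ l : α, ∑ b ∈ S, f a i l * g b i l := Finset.sum_comm
    _ = ∑ a ∈ S, ∑ i : α, ∑ b ∈ S, ∑ l : α, f a i l * g b i l :=
        Finset.sum_congr rfl fun a _ => Finset.sum_congr rfl fun i _ => Finset.sum_comm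
    _ = ∑ a ∈ S, ∑ b ∈ S, ∑ i : α, ∑ l : α, f a i l * g b i l :=
        Finset.sum_congr rfl fun a _ => Finset.sum_comm

/-- **Gram positivity for link-bisected `π`-rectangles** (complex form): for `L` even, `β ≥ 0`,
heights `a + 1 ≤ L/2` and real coefficients,
`0 ≤ ⟨∑_{a,b} c_a c_b tr σ_π(W_{(a+b+1) × R} based at (-b, 0⃗))⟩_{Λ_L,β}` under the torus Wilson
state of `ρ` (reflection positivity in the hyperplane between time slices applied to the covariant
`π`-words). [cite: SeilerLNP1982, §2] -/
theorem wilsonExpectation_gramRep_link_nonneg (hL : Even L) (hρ : Continuous ρ) {β : ℝ}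
    (hβ : 0 ≤ β) (hπ : Continuous π) {j : Fin d} (hj : j ≠ 0) (R : ℕ) (S : Finset ℕ)
    (hS : ∀ a ∈ S, a + 1 ≤ L / 2) (c : ℕ → ℝ) :
    0 ≤ wilsonExpectation ρ β fun U : GaugeConfig d L G => ∑ a ∈ S, ∑ b ∈ S, (c a * c b : ℂ) *
      (CompactGroup.unitarize π hπ (rectangleHolonomy U (tBase b) 0 j (a + b + 1) R)).trace := by
  set σ := CompactGroup.unitarize π hπ with hσdef
  refine wilsonExpectation_nonneg_of_covariant ρ hL hρ hβ (K := Fin M × Fin M)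
    (g := fun il V => ∑ a ∈ S, (c a : ℂ) * σ (linkWord j R a V) il.1 il.2)
    (fun il => Finset.measurable_sum _ fun a _ =>
      (entryMeasurable_linkWord π hπ j R a il.1 il.2).const_mul _)
    (Kg := ∑ a ∈ S, ‖(c a : ℂ)‖) (fun il V => ?_) (fun il => ?_) ?_ ?_
  · -- bound
    refine (norm_sum_le _ _).trans (Finset.sum_le_sum fun a _ => ?_)
    rw [norm_mul]
    exact mul_le_of_le_one_right (norm_nonneg _)
      (CompactGroup.norm_unitarize_apply_le_one π hπ _ _ _)
  · -- dependence on `P ∪ C`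
    intro U V hUV
    refine Finset.sum_congr rfl fun a ha => ?_
    have hP : ∀ e, IsPosEdge e → U e = V e := fun e he => hUV e (by simp [he])
    have hC : ∀ e, IsCrossEdge e → U e = V e := fun e he => hUV e (by simp [he])
    obtain ⟨hc0, hcR⟩ := isLowerCross_foot (L := L) j hj R
    simp only [linkWord, hC _ hc0.isCrossEdge, hC _ hcR.isCrossEdge,
      linkStaple_congr j R a fun e he => hP e (isPosEdge_of_isLinkStapleEdge hj (hS a ha) he)]
  · -- measurability of `Φ`
    refine Finset.measurable_sum _ fun a _ => Finset.measurable_sum _ fun b _ => ?_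
    exact (entryMeasurable_rectangleHolonomy π hπ _ _ _ _ _).measurable_trace.const_mul _
  · -- covariance
    intro U Y
    have hL' : (∑ a ∈ S, ∑ b ∈ S, (c a * c b : ℂ) *
        (σ (rectangleHolonomy (translate Y U) (tBase b) 0 j (a + b + 1) R)).trace) =
        ∑ a ∈ S, ∑ b ∈ S, ∑ i, ∑ l, (c a * c b : ℂ) *
          (σ (linkWord j R a (LatticeRP.splice crossEdges (U, Y))) i l *
            conj (σ (linkWord j R b U.timeReflect) i l)) := by
      refine Finset.sum_congr rfl fun a ha => Finset.sum_congr rfl fun b hb => ?_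
      rw [trace_rectangleHolonomy_translate π hL hπ hj (hS a ha) (hS b hb) U Y, Finset.mul_sum]
      refine Finset.sum_congr rfl fun i _ => ?_
      rw [Finset.mul_sum]
    rw [hL', Fintype.sum_prod_type]
    simp only [map_sum, map_mul, Complex.conj_ofReal]
    rw [sum_sum_mul_sum_sum']
    refine Finset.sum_congr rfl fun a _ => Finset.sum_congr rfl fun b _ =>
      Finset.sum_congr rfl fun i _ => Finset.sum_congr rfl fun l _ => by ring

/-- **Gram positivity for site-bisected `π`-rectangles** (complex form): for `L` even, any real
`β`, heights `a ≤ L/2` and real coefficients,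
`0 ≤ ⟨∑_{a,b} c_a c_b tr σ_π(W_{(a+b) × R} based at (-b, 0⃗))⟩_{Λ_L,β}` (reflection positivity in the
hyperplane through sites applied to the `π`-staples). [cite: SeilerLNP1982, §2] -/
theorem wilsonExpectation_gramRep_site_nonneg (hL : Even L) (hρ : Continuous ρ) (β : ℝ)
    (hπ : Continuous π) {j : Fin d} (hj : j ≠ 0) (R : ℕ) (S : Finset ℕ)
    (hS : ∀ a ∈ S, a ≤ L / 2) (c : ℕ → ℝ) :
    0 ≤ wilsonExpectation ρ β fun U : GaugeConfig d L G => ∑ a ∈ S, ∑ b ∈ S, (c a * c b : ℂ) *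
      (CompactGroup.unitarize π hπ (rectangleHolonomy U (tBase b) 0 j (a + b) R)).trace := by
  set σ := CompactGroup.unitarize π hπ with hσdef
  haveI := isProbabilityMeasure_wilsonMeasure (d := d) (L := L) ρ hρ β
  -- the family `F_{il} = ∑_a c_a σ(staple'_a)_{il}`
  set F : Fin M × Fin M → GaugeConfig d L G → ℂ :=
    fun il V => ∑ a ∈ S, (c a : ℂ) * σ (siteStaple j R a V) il.1 il.2 with hFdef
  have hFm : ∀ il, Measurable (F il) := fun il =>
    Finset.measurable_sum _ fun a _ => (entryMeasurable_siteStaple π hπ j R a il.1 il.2).const_mul _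
  have hFb : ∀ il V, ‖F il V‖ ≤ ∑ a ∈ S, ‖(c a : ℂ)‖ := fun il V => by
    refine (norm_sum_le _ _).trans (Finset.sum_le_sum fun a _ => ?_)
    rw [norm_mul]
    exact mul_le_of_le_one_right (norm_nonneg _)
      (CompactGroup.norm_unitarize_apply_le_one π hπ _ _ _)
  have hFdep : ∀ il, DependsOn (F il)
      ((sitePosEdges ∪ sharedEdges : Finset (Edge d L)) : Set (Edge d L)) := by
    intro il U V hUV
    refine Finset.sum_congr rfl fun a ha => ?_
    have h : ∀ e, IsSitePosEdge e ∨ IsSharedEdge e → U e = V e := fun e he => hUV e (by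
      rcases he with he | he <;> simp [he])
    simp only [siteStaple_congr j R a fun e he =>
      h e (isSitePosEdge_or_isSharedEdge_of_isSiteStapleEdge hj (hS a ha) he)]
  -- positivity of each `⟨conj F_{il}(Θ'U) F_{il}(U)⟩`
  have hpos : ∀ il, 0 ≤ wilsonExpectation ρ β fun U => conj (F il U.negReflect) * F il U := fun il =>
    wilsonExpectation_siteReflectionPositive ρ hL hρ β (F il) (hFm il) ⟨_, hFb il⟩ (hFdep il)
  -- the pointwise identity `∑_{il} conj F_{il}(Θ'U) F_{il}(U) = Φ(U)`
  have hpt : ∀ U : GaugeConfig d L G, (∑ il : Fin M × Fin M, conj (F il U.negReflect) * F il U) =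
      ∑ a ∈ S, ∑ b ∈ S, (c a * c b : ℂ) * (σ (rectangleHolonomy U (tBase b) 0 j (a + b) R)).trace := by
    intro U
    have hR : ∀ a b, (σ (rectangleHolonomy U (tBase b) 0 j (a + b) R)).trace =
        ∑ i, ∑ l, σ (siteStaple j R a U) i l * conj (σ (siteStaple j R b U.negReflect) i l) := by
      intro a b
      rw [rectangleHolonomy_eq_site U hj, CompactGroup.trace_conj_eq, trace_unitarize_mul_inv π hπ]
    simp_rw [hR]
    rw [Fintype.sum_prod_type]
    simp only [hFdef, map_sum, map_mul, Complex.conj_ofReal]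
    have h2 : ∀ a b, (c a * c b : ℂ) * ∑ i, ∑ l, σ (siteStaple j R a U) i l *
        conj (σ (siteStaple j R b U.negReflect) i l) =
        ∑ i, ∑ l, (c a * c b : ℂ) * (σ (siteStaple j R a U) i l *
          conj (σ (siteStaple j R b U.negReflect) i l)) := by
      intro a b
      rw [Finset.mul_sum]
      refine Finset.sum_congr rfl fun i _ => ?_
      rw [Finset.mul_sum]
    simp_rw [h2]
    rw [show (∑ i : Fin M, ∑ l : Fin M, (∑ b ∈ S, (c b : ℂ) * conj (σ (siteStaple j R b U.negReflect) i l)) *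
        ∑ a ∈ S, (c a : ℂ) * σ (siteStaple j R a U) i l) =
        ∑ i : Fin M, ∑ l : Fin M, (∑ a ∈ S, (c a : ℂ) * σ (siteStaple j R a U) i l) *
          ∑ b ∈ S, (c b : ℂ) * conj (σ (siteStaple j R b U.negReflect) i l) from
      Finset.sum_congr rfl fun i _ => Finset.sum_congr rfl fun l _ => mul_comm _ _,
      sum_sum_mul_sum_sum']
    refine Finset.sum_congr rfl fun a _ => Finset.sum_congr rfl fun b _ =>
      Finset.sum_congr rfl fun i _ => Finset.sum_congr rfl fun l _ => by ring
  -- linearity of the expectation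
  have hint : ∀ il, Integrable (fun U : GaugeConfig d L G => conj (F il U.negReflect) * F il U)
      (wilsonMeasure ρ β) := fun il =>
    Integrable.of_bound
      ((Complex.continuous_conj.measurable.comp ((hFm il).comp measurable_negReflect)).mul
        (hFm il)).aestronglyMeasurable ((∑ a ∈ S, ‖(c a : ℂ)‖) * ∑ a ∈ S, ‖(c a : ℂ)‖)
      (ae_of_all _ fun U => by
        rw [norm_mul, Complex.norm_conj]
        exact mul_le_mul (hFb _ _) (hFb _ _) (norm_nonneg _)
          ((norm_nonneg _).trans (hFb il U)))
  have hsum : wilsonExpectation ρ β (fun U : GaugeConfig d L G => ∑ a ∈ S, ∑ b ∈ S,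
      (c a * c b : ℂ) * (σ (rectangleHolonomy U (tBase b) 0 j (a + b) R)).trace) =
      ∑ il : Fin M × Fin M, wilsonExpectation ρ β fun U => conj (F il U.negReflect) * F il U := by
    unfold wilsonExpectation
    rw [← integral_finsetSum _ fun il _ => hint il]
    exact integral_congr_ae (ae_of_all _ fun U => (hpt U).symm)
  rw [hsum]
  exact Finset.sum_nonneg fun il _ => hpos il

/-! ### From complex Gram positivity to the real `π`-loop expectations -/

omit [NeZero d] [Fact (1 < L)] in
/-- `π`-loop expectations under the `ρ`-state do not depend on the base point (translation
invariance of the torus Wilson state). [folklore] -/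
private theorem wilsonExpectation_wilsonLoopRep_base (β : ℝ) (x : Site d L) (i j : Fin d)
    (R T : ℕ) :
    wilsonExpectation ρ β (wilsonLoop π x i j R T) =
      wilsonExpectation ρ β (wilsonLoop π (0 : Site d L) i j R T) := by
  rw [← wilsonExpectation_comp_torusConfigShift ρ β (-x) (wilsonLoop π (0 : Site d L) i j R T)]
  congr 1
  funext U
  simp only [Function.comp_apply, wilsonLoop, rectangleHolonomy_torusConfigShift, zero_sub, neg_neg]

omit [Fact (1 < L)] in
/-- The real part of a Gram expectation of unitarised `π`-loop traces is the Gram sum of the real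
`π`-loop expectations (linearity, `Re tr σ_π = Re tr π`, translation to the base point `0`).
[folklore] -/
private theorem re_wilsonExpectation_gramRep (hρ : Continuous ρ) (hπ : Continuous π) (hM : M ≠ 0)
    (β : ℝ) (j : Fin d) (R : ℕ) (h : ℕ → ℕ → ℕ) (S : Finset ℕ) (c : ℕ → ℝ) :
    (wilsonExpectation ρ β fun U : GaugeConfig d L G => ∑ a ∈ S, ∑ b ∈ S, (c a * c b : ℂ) *
      (CompactGroup.unitarize π hπ (rectangleHolonomy U (tBase b) 0 j (h a b) R)).trace).re =
      M * ∑ a ∈ S, ∑ b ∈ S, c a * c b *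
        wilsonExpectation ρ β (wilsonLoop π (0 : Site d L) 0 j (h a b) R) := by
  set σ := CompactGroup.unitarize π hπ with hσdef
  haveI := isProbabilityMeasure_wilsonMeasure (d := d) (L := L) ρ hρ β
  have htm : ∀ a b, Measurable fun U : GaugeConfig d L G =>
      (σ (rectangleHolonomy U (tBase b) 0 j (h a b) R)).trace := fun a b =>
    (entryMeasurable_rectangleHolonomy π hπ _ _ _ _ _).measurable_trace
  have htb : ∀ a b (U : GaugeConfig d L G),
      ‖(σ (rectangleHolonomy U (tBase b) 0 j (h a b) R)).trace‖ ≤ M := fun a b U => by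
    rw [Matrix.trace]
    refine (norm_sum_le _ _).trans ?_
    calc ∑ k, ‖Matrix.diag (σ (rectangleHolonomy U (tBase b) 0 j (h a b) R)) k‖
        ≤ ∑ _k : Fin M, (1 : ℝ) := Finset.sum_le_sum fun k _ =>
          CompactGroup.norm_unitarize_apply_le_one π hπ _ k k
      _ = M := by simp
  have hint : ∀ a b, Integrable (fun U : GaugeConfig d L G =>
      (c a * c b : ℂ) * (σ (rectangleHolonomy U (tBase b) 0 j (h a b) R)).trace)
      (wilsonMeasure ρ β) := fun a b =>
    (Integrable.of_bound (μ := wilsonMeasure ρ β) (htm a b).aestronglyMeasurable _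
      (ae_of_all _ (htb a b))).const_mul _
  unfold wilsonExpectation
  rw [integral_finsetSum _ fun a _ => integrable_finsetSum _ fun b _ => hint a b, Complex.re_sum,
    Finset.mul_sum]
  refine Finset.sum_congr rfl fun a _ => ?_
  rw [integral_finsetSum _ fun b _ => hint a b, Complex.re_sum, Finset.mul_sum]
  refine Finset.sum_congr rfl fun b _ => ?_
  have hre : (∫ U : GaugeConfig d L G,
      (σ (rectangleHolonomy U (tBase b) 0 j (h a b) R)).trace ∂wilsonMeasure ρ β).re =
      ∫ U : GaugeConfig d L G,
        ((σ (rectangleHolonomy U (tBase b) 0 j (h a b) R)).trace).re ∂wilsonMeasure ρ β := by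
    have := integral_re (Integrable.of_bound (μ := wilsonMeasure ρ β) (htm a b).aestronglyMeasurable _
      (ae_of_all _ (htb a b)))
    simpa only [RCLike.re_to_complex] using this.symm
  have hI : ∫ U : GaugeConfig d L G,
      ((σ (rectangleHolonomy U (tBase b) 0 j (h a b) R)).trace).re ∂wilsonMeasure ρ β =
      M * ∫ U : GaugeConfig d L G, wilsonLoop π (tBase b) 0 j (h a b) R U ∂wilsonMeasure ρ β := by
    rw [← integral_const_mul]
    refine integral_congr_ae (ae_of_all _ fun U => ?_)
    simp only [hσdef, CompactGroup.trace_unitarize, re_trace_eq_mul_wilsonLoop π hM]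
  have hW := wilsonExpectation_wilsonLoopRep_base ρ π β (tBase b : Site d L) 0 j (h a b) R
  unfold wilsonExpectation at hW
  rw [integral_const_mul, ← Complex.ofReal_mul, Complex.re_ofReal_mul, hre, hI, ← hW]
  ring

/-- **Gram inequality for `π`-loops of odd height** (torus form): for `L` even, `β ≥ 0`,
continuous `ρ` (action) and `π` (loop), a spatial direction `j ≠ 0`, heights `a + 1 ≤ L/2`
(`a ∈ S`) and real coefficients `c`,
`0 ≤ ∑_{a,b ∈ S} c_a c_b ⟨W^π_{(a+b+1) × R}⟩_{Λ_L,β}`. [cite: SeilerLNP1982, §2] -/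
theorem gram_wilsonLoopRep_nonneg_link (hL : Even L) (hρ : Continuous ρ) {β : ℝ} (hβ : 0 ≤ β)
    (hπ : Continuous π) {j : Fin d} (hj : j ≠ 0) (R : ℕ) (S : Finset ℕ)
    (hS : ∀ a ∈ S, a + 1 ≤ L / 2) (c : ℕ → ℝ) :
    0 ≤ ∑ a ∈ S, ∑ b ∈ S, c a * c b *
      wilsonExpectation ρ β (wilsonLoop π (0 : Site d L) 0 j (a + b + 1) R) := by
  rcases Nat.eq_zero_or_pos M with hM | hM
  · subst hM
    simp [wilsonLoop, wilsonExpectation]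
  have h := (Complex.nonneg_iff.1
    (wilsonExpectation_gramRep_link_nonneg ρ π hL hρ hβ hπ hj R S hS c)).1
  rw [re_wilsonExpectation_gramRep ρ π hρ hπ hM.ne' β j R (fun a b => a + b + 1) S c] at h
  exact nonneg_of_mul_nonneg_right h (Nat.cast_pos.2 hM)

/-- **Gram inequality for `π`-loops of even height** (torus form): for `L` even, any real `β`,
continuous `ρ` and `π`, `j ≠ 0`, heights `a ≤ L/2` (`a ∈ S`) and real coefficients `c`,
`0 ≤ ∑_{a,b ∈ S} c_a c_b ⟨W^π_{(a+b) × R}⟩_{Λ_L,β}`. [cite: SeilerLNP1982, §2] -/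
theorem gram_wilsonLoopRep_nonneg_site (hL : Even L) (hρ : Continuous ρ) (β : ℝ)
    (hπ : Continuous π) {j : Fin d} (hj : j ≠ 0) (R : ℕ) (S : Finset ℕ)
    (hS : ∀ a ∈ S, a ≤ L / 2) (c : ℕ → ℝ) :
    0 ≤ ∑ a ∈ S, ∑ b ∈ S, c a * c b *
      wilsonExpectation ρ β (wilsonLoop π (0 : Site d L) 0 j (a + b) R) := by
  rcases Nat.eq_zero_or_pos M with hM | hM
  · subst hM
    simp [wilsonLoop, wilsonExpectation]
  have h := (Complex.nonneg_iff.1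
    (wilsonExpectation_gramRep_site_nonneg ρ π hL hρ β hπ hj R S hS c)).1
  rw [re_wilsonExpectation_gramRep ρ π hρ hπ hM.ne' β j R (fun a b => a + b) S c] at h
  exact nonneg_of_mul_nonneg_right h (Nat.cast_pos.2 hM)

end Gram

end WilsonLoopRP

/-! ## The torus theorems without the `Fact (1 < L)` instance, and their consequences -/

section Main

variable {d L N M : ℕ} {G : Type*} [Group G] [TopologicalSpace G] [IsTopologicalGroup G]
  [CompactSpace G] [MeasurableSpace G] [BorelSpace G]
  (ρ : G →* Matrix (Fin N) (Fin N) ℂ) (π : G →* Matrix (Fin M) (Fin M) ℂ)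

/-- **Gram inequality for `π`-loops of odd height on the even torus** (reflection positivity in
the hyperplane between time slices; E. Seiler, LNP 159 §2). For `L` even, `β ≥ 0`, continuous
`ρ` (the action) and `π` (the loop), a spatial direction `j ≠ 0`, heights `a + 1 ≤ L/2` and real
coefficients: `0 ≤ ∑_{a,b ∈ S} c_a c_b ⟨W^π_{(a+b+1) × R}⟩_{Λ_L,β}` for the rectangular `π`-loops at
the origin with `a + b + 1` steps in the time direction `0` and `R` steps in direction `j`
(`wilsonLoop π 0 0 j (a+b+1) R`). [cite: SeilerLNP1982, §2] -/
theorem gram_wilsonLoopRep_nonneg_odd [NeZero d] [NeZero L] (hL : Even L) (hρ : Continuous ρ)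
    {β : ℝ} (hβ : 0 ≤ β) (hπ : Continuous π) {j : Fin d} (hj : j ≠ 0) (R : ℕ) (S : Finset ℕ)
    (hS : ∀ a ∈ S, a + 1 ≤ L / 2) (c : ℕ → ℝ) :
    0 ≤ ∑ a ∈ S, ∑ b ∈ S, c a * c b *
      wilsonExpectation ρ β (wilsonLoop π (0 : Site d L) 0 j (a + b + 1) R) := by
  haveI : Fact (1 < L) := ⟨by
    obtain ⟨r, hr⟩ := hL
    have := NeZero.ne L
    omega⟩
  exact WilsonLoopRP.gram_wilsonLoopRep_nonneg_link ρ π hL hρ hβ hπ hj R S hS c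

/-- **Gram inequality for `π`-loops of even height on the even torus** (reflection positivity in
the hyperplane through sites; any real `β`). For `L` even, continuous `ρ` and `π`, `j ≠ 0`,
heights `a ≤ L/2` and real coefficients: `0 ≤ ∑_{a,b ∈ S} c_a c_b ⟨W^π_{(a+b) × R}⟩_{Λ_L,β}`.
[cite: SeilerLNP1982, §2] -/
theorem gram_wilsonLoopRep_nonneg_even [NeZero d] [NeZero L] (hL : Even L) (hρ : Continuous ρ)
    (β : ℝ) (hπ : Continuous π) {j : Fin d} (hj : j ≠ 0) (R : ℕ) (S : Finset ℕ)
    (hS : ∀ a ∈ S, a ≤ L / 2) (c : ℕ → ℝ) :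
    0 ≤ ∑ a ∈ S, ∑ b ∈ S, c a * c b *
      wilsonExpectation ρ β (wilsonLoop π (0 : Site d L) 0 j (a + b) R) := by
  haveI : Fact (1 < L) := ⟨by
    obtain ⟨r, hr⟩ := hL
    have := NeZero.ne L
    omega⟩
  exact WilsonLoopRP.gram_wilsonLoopRep_nonneg_site ρ π hL hρ β hπ hj R S hS c

/-! ### `W(0) = 1`, positivity, log-convexity -/

omit [TopologicalSpace G] [IsTopologicalGroup G] [CompactSpace G] [MeasurableSpace G]
  [BorelSpace G] in
/-- The degenerate `0 × R` rectangle has trivial holonomy. [folklore] -/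
private theorem rectangleHolonomy_zero_fst (U : GaugeConfig d L G) (x : Site d L) (i j : Fin d)
    (R : ℕ) : rectangleHolonomy U x i j 0 R = 1 := by
  simp only [rectangleHolonomy, lineHolonomy, Nat.cast_zero, Pi.single_zero, add_zero, one_mul,
    inv_one, mul_one, mul_inv_cancel]

omit [TopologicalSpace G] [IsTopologicalGroup G] [CompactSpace G] [MeasurableSpace G]
  [BorelSpace G] in
/-- The degenerate `0 × R` `π`-loop observable is the constant `1` (`M ≥ 1`). [folklore] -/
private theorem wilsonLoop_zero_fst (hM : M ≠ 0) (x : Site d L) (i j : Fin d) (R : ℕ)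
    (U : GaugeConfig d L G) : wilsonLoop π x i j 0 R U = 1 := by
  rw [wilsonLoop, rectangleHolonomy_zero_fst, map_one, Matrix.trace_one, Fintype.card_fin,
    Complex.natCast_re, inv_mul_cancel₀ (Nat.cast_ne_zero.2 hM)]

/-- **`⟨W^π_{0 × R}⟩_{Λ_L,β} = 1`**: the degenerate loop (`M ≥ 1`, continuous `ρ`, any real `β`).
[folklore] -/
private theorem wilsonExpectation_wilsonLoopRep_zero [NeZero L] (hρ : Continuous ρ) (β : ℝ)
    (hM : M ≠ 0) (x : Site d L) (i j : Fin d) (R : ℕ) :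
    wilsonExpectation ρ β (wilsonLoop π x i j 0 R) = 1 := by
  haveI := isProbabilityMeasure_wilsonMeasure (d := d) (L := L) ρ hρ β
  have h : wilsonLoop π x i j 0 R = fun _ : GaugeConfig d L G => (1 : ℝ) :=
    funext fun U => wilsonLoop_zero_fst π hM x i j R U
  rw [h]
  simp [wilsonExpectation]

/-- The `2 × 2` Gram sum over `{a, a+1}` is the quadratic form of its three entries. [folklore] -/
private theorem quad_of_gram_pair' {W : ℕ → ℝ} {h : ℕ → ℕ → ℕ} {a p q r : ℕ} {x y : ℝ}
    (hp : h a a = p) (hq : h a (a + 1) = q) (hq' : h (a + 1) a = q) (hr : h (a + 1) (a + 1) = r)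
    (hG : 0 ≤ ∑ s ∈ ({a, a + 1} : Finset ℕ), ∑ t ∈ ({a, a + 1} : Finset ℕ),
      (if s = a then x else y) * (if t = a then x else y) * W (h s t)) :
    0 ≤ W p * x ^ 2 + 2 * W q * x * y + W r * y ^ 2 := by
  have hne : a ≠ a + 1 := by omega
  rw [Finset.sum_pair hne, Finset.sum_pair hne, Finset.sum_pair hne] at hG
  simp only [↓reduceIte, if_neg hne.symm, hp, hq, hq', hr] at hG
  have e : W p * x ^ 2 + 2 * W q * x * y + W r * y ^ 2 =
      x * x * W p + x * y * W q + (y * x * W q + y * y * W r) := by ring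
  rw [e]
  exact hG

/-- **Positivity of rectangular `π`-loop expectations on the even torus**: for `L` even, `β ≥ 0`,
continuous `ρ` and `π`, `j ≠ 0`, `h + 1 ≤ L` and any `R`, `0 ≤ ⟨W^π_{h × R}⟩_{Λ_L,β}` (the
diagonal entries of the two Gram matrices). [cite: SeilerLNP1982, §2] -/
theorem wilsonExpectation_wilsonLoopRep_nonneg [NeZero d] [NeZero L] (hL : Even L)
    (hρ : Continuous ρ) {β : ℝ} (hβ : 0 ≤ β) (hπ : Continuous π) {j : Fin d} (hj : j ≠ 0)
    {h : ℕ} (hh : h + 1 ≤ L) (R : ℕ) :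
    0 ≤ wilsonExpectation ρ β (wilsonLoop π (0 : Site d L) 0 j h R) := by
  rcases Nat.even_or_odd' h with ⟨a, rfl | rfl⟩
  · have hG := gram_wilsonLoopRep_nonneg_even ρ π hL hρ β hπ hj R {a}
      (fun s hs => by rw [Finset.mem_singleton] at hs; omega) (fun _ => 1)
    simpa [two_mul] using hG
  · have hG := gram_wilsonLoopRep_nonneg_odd ρ π hL hρ hβ hπ hj R {a}
      (fun s hs => by rw [Finset.mem_singleton] at hs; omega) (fun _ => 1)
    simpa [two_mul] using hG

/-- **Log-convexity of rectangular `π`-loop expectations in the time direction on the even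
torus** — Bachas' reflection-positivity inequality (8) for loops in an arbitrary representation:
for `L` even, `β ≥ 0`, continuous `ρ` and `π`, `j ≠ 0`, `h + 3 ≤ L` and any `R`,
`⟨W^π_{(h+1) × R}⟩² ≤ ⟨W^π_{h × R}⟩ ⟨W^π_{(h+2) × R}⟩` (the `2 × 2` minors of the two Gram matrices).
[cite: Bachas1986, eq. (8)] -/
theorem wilsonExpectation_wilsonLoopRep_sq_le [NeZero d] [NeZero L] (hL : Even L)
    (hρ : Continuous ρ) {β : ℝ} (hβ : 0 ≤ β) (hπ : Continuous π) {j : Fin d} (hj : j ≠ 0)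
    {h : ℕ} (hh : h + 3 ≤ L) (R : ℕ) :
    wilsonExpectation ρ β (wilsonLoop π (0 : Site d L) 0 j (h + 1) R) ^ 2 ≤
      wilsonExpectation ρ β (wilsonLoop π (0 : Site d L) 0 j h R) *
        wilsonExpectation ρ β (wilsonLoop π (0 : Site d L) 0 j (h + 2) R) := by
  set W : ℕ → ℝ := fun n => wilsonExpectation ρ β (wilsonLoop π (0 : Site d L) 0 j n R) with hW
  rcases Nat.even_or_odd' h with ⟨a, rfl | rfl⟩
  · -- `h = 2a`: lattice hyperplanes, heights `{a, a+1}`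
    have hq : ∀ x y : ℝ,
        0 ≤ W (a + a) * x ^ 2 + 2 * W (a + a + 1) * x * y + W (a + a + 2) * y ^ 2 := by
      intro x y
      have hG := gram_wilsonLoopRep_nonneg_even ρ π hL hρ β hπ hj R {a, a + 1}
        (fun s hs => by
          rw [Finset.mem_insert, Finset.mem_singleton] at hs
          omega) (fun u => if u = a then x else y)
      exact quad_of_gram_pair' (W := W) (h := fun s t => s + t) (a := a) rfl rfl (by omega)
        (by omega) hG
    have := StaticPotential.sq_le_mul_of_forall_quadratic_nonneg hq
    rw [two_mul]
    exact this
  · -- `h = 2a + 1`: hyperplanes between time slices, heights `{a, a+1}`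
    have hq : ∀ x y : ℝ,
        0 ≤ W (a + a + 1) * x ^ 2 + 2 * W (a + a + 2) * x * y + W (a + a + 3) * y ^ 2 := by
      intro x y
      have hG := gram_wilsonLoopRep_nonneg_odd ρ π hL hρ hβ hπ hj R {a, a + 1}
        (fun s hs => by
          rw [Finset.mem_insert, Finset.mem_singleton] at hs
          omega) (fun u => if u = a then x else y)
      exact quad_of_gram_pair' (W := W) (h := fun s t => s + t + 1) (a := a) rfl rfl (by omega)
        (by omega) hG
    have := StaticPotential.sq_le_mul_of_forall_quadratic_nonneg hq
    rw [two_mul, show a + a + 1 + 1 = a + a + 2 by ring, show a + a + 1 + 2 = a + a + 3 by ring]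
    exact this

/-! ### The Seiler–Bachas lower bounds -/

/-- A non-negative log-convex sequence with `W(0) = 1` dominates the geometric sequence through
`W(1)` (zeros allowed), on an initial segment. [folklore] -/
private theorem pow_le_of_logConvex_nonneg {W : ℕ → ℝ} {K : ℕ} (h0 : W 0 = 1)
    (hnn : ∀ n, n ≤ K → 0 ≤ W n) (hconv : ∀ n, n + 2 ≤ K → W (n + 1) ^ 2 ≤ W n * W (n + 2)) :
    ∀ n, n ≤ K → W 1 ^ n ≤ W n := by
  intro n hn
  rcases n with _ | m
  · simp [h0]
  have h1 : 0 ≤ W 1 := hnn 1 (by omega)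
  rcases h1.eq_or_lt with hz | hpos
  · -- `W 1 = 0`
    rw [← hz, zero_pow (Nat.succ_ne_zero m)]
    exact hnn _ hn
  · -- `W 1 > 0`: `0 < W n` and `W 1 * W n ≤ W (n+1)` by induction
    have key : ∀ n, n + 1 ≤ K → 0 < W n ∧ W 1 * W n ≤ W (n + 1) := by
      intro n
      induction n with
      | zero => intro _; exact ⟨by rw [h0]; exact one_pos, by rw [h0, mul_one]⟩
      | succ n ih =>
        intro hn'
        obtain ⟨hposn, hstep⟩ := ih (by omega)
        have hpos1 : 0 < W (n + 1) := lt_of_lt_of_le (mul_pos hpos hposn) hstep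
        refine ⟨hpos1, ?_⟩
        have hc := hconv n (by omega)
        -- `W1 W(n+1) Wn ≤ W(n+1)² ≤ Wn W(n+2)`
        have h3 : W 1 * W (n + 1) * W n ≤ W (n + 2) * W n := by
          calc W 1 * W (n + 1) * W n = W (n + 1) * (W 1 * W n) := by ring
            _ ≤ W (n + 1) * W (n + 1) := mul_le_mul_of_nonneg_left hstep hpos1.le
            _ = W (n + 1) ^ 2 := (sq _).symm
            _ ≤ W n * W (n + 2) := hc
            _ = W (n + 2) * W n := mul_comm _ _
        exact le_of_mul_le_mul_right h3 hposn
    have main : ∀ k, k + 1 ≤ K → W 1 ^ (k + 1) ≤ W (k + 1) := by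
      intro k
      induction k with
      | zero => intro _; simp
      | succ k ih =>
        intro hk
        calc W 1 ^ (k + 1 + 1) = W 1 * W 1 ^ (k + 1) := by ring
          _ ≤ W 1 * W (k + 1) := mul_le_mul_of_nonneg_left (ih (by omega)) hpos.le
          _ ≤ W (k + 1 + 1) := (key (k + 1) hk).2
    exact main m hn

/-- **`⟨W^π_{1 × R}⟩^h ≤ ⟨W^π_{h × R}⟩` on the even torus** (powers in the time direction): for
`L` even, `β ≥ 0`, continuous `ρ` and `π`, `M ≥ 1`, `j ≠ 0` and `h + 1 ≤ L`, the rectangular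
`π`-loop expectation dominates the `h`-th power of the height-one loop of the same width —
transfer-matrix positivity iterated from the degenerate loop `⟨W^π_{0 × R}⟩ = 1` (a consequence of
Bachas' (8), not printed in this form). [cite: Bachas1986, eq. (8)] -/
theorem pow_wilsonExpectation_wilsonLoopRep_le [NeZero d] [NeZero L] (hL : Even L)
    (hρ : Continuous ρ) {β : ℝ} (hβ : 0 ≤ β) (hπ : Continuous π) (hM : M ≠ 0) {j : Fin d}
    (hj : j ≠ 0) {h : ℕ} (hh : h + 1 ≤ L) (R : ℕ) :
    wilsonExpectation ρ β (wilsonLoop π (0 : Site d L) 0 j 1 R) ^ h ≤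
      wilsonExpectation ρ β (wilsonLoop π (0 : Site d L) 0 j h R) := by
  set W : ℕ → ℝ := fun n => wilsonExpectation ρ β (wilsonLoop π (0 : Site d L) 0 j n R) with hW
  have h0 : W 0 = 1 := wilsonExpectation_wilsonLoopRep_zero ρ π hρ β hM 0 0 j R
  exact pow_le_of_logConvex_nonneg (K := L - 1) h0
    (fun n hn => wilsonExpectation_wilsonLoopRep_nonneg ρ π hL hρ hβ hπ hj (by omega) R)
    (fun n hn => wilsonExpectation_wilsonLoopRep_sq_le ρ π hL hρ hβ hπ hj (by omega) R) h
    (by omega)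

/-- **Symmetry of the torus `π`-loop expectations in the `(0,1)` plane**:
`⟨W^π_{h × R}⟩ = ⟨W^π_{R × h}⟩` (coordinate exchange `0 ↔ 1` of the torus Wilson state of `ρ`,
orientation reversal of the loop, `Re tr π(g⁻¹) = Re tr π(g)`). [folklore] -/
private theorem wilsonExpectation_wilsonLoopRep_swap [NeZero d] [NeZero L] (hρ : Continuous ρ)
    (hπ : Continuous π) (β : ℝ) (h R : ℕ) :
    wilsonExpectation ρ β (wilsonLoop π (0 : Site d L) 0 1 h R) =
      wilsonExpectation ρ β (wilsonLoop π (0 : Site d L) 0 1 R h) := by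
  rw [← StringTension.wilsonExpectation_comp_swap ρ hρ β (wilsonLoop π (0 : Site d L) 0 1 h R)]
  congr 1
  funext U
  exact StringTension.wilsonLoop_swap π hπ h R U

/-- **The Seiler–Bachas plaquette lower bound on the even torus, arbitrary loop representation:**
`⟨W^π_{1 × 1}⟩^{h R} ≤ ⟨W^π_{h × R}⟩_{Λ_L,β}` for the rectangular `π`-loops of the `(0,1)` plane,
`L` even, `β ≥ 0`, continuous `ρ` (action) and `π` (loop), `M ≥ 1`, `h + 1 ≤ L`, `R + 1 ≤ L`, and
`d ≥ 2`. Every rectangular Wilson loop expectation in the representation `π` under the torus Wilson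
state of `ρ` is bounded below by the mean `π`-plaquette raised to the enclosed area — reflection
positivity in both directions; the torus, general-representation form of "the potential between
color charges cannot rise faster than linearly with distance" [cite: Seiler1978, abstract] and of
the loop-level inequality `W(1,1)^{RT} ≤ W(R,T)` (tree: `StaticPotential.plaquette_pow_le_rectExpectation`
for limit states and `π = ρ`). In particular an area law `⟨W^π_{h×R}⟩ ≤ C^{2(h+R)} e^{-s h R}` on
all large even tori with `⟨W^π_{1×1}⟩ ≥ w > 0` forces `s ≤ -log w`. [cite: Bachas1986, eq. (8)] -/
theorem plaquette_pow_le_wilsonExpectation_wilsonLoopRep [NeZero d] [NeZero L] (hd : 2 ≤ d)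
    (hL : Even L) (hρ : Continuous ρ) {β : ℝ} (hβ : 0 ≤ β) (hπ : Continuous π) (hM : M ≠ 0)
    {h R : ℕ} (hh : h + 1 ≤ L) (hR : R + 1 ≤ L) :
    wilsonExpectation ρ β (wilsonLoop π (0 : Site d L) 0 1 1 1) ^ (h * R) ≤
      wilsonExpectation ρ β (wilsonLoop π (0 : Site d L) 0 1 h R) := by
  have h10 : (1 : Fin d) ≠ 0 := by
    intro h01
    have := congrArg Fin.val h01
    rw [Fin.val_zero, Fin.val_one', Nat.one_mod_eq_one.mpr (by omega)] at this
    exact one_ne_zero this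
  have h2L : 2 ≤ L := by
    obtain ⟨r, hr⟩ := hL
    have := NeZero.ne L
    omega
  have hP : 0 ≤ wilsonExpectation ρ β (wilsonLoop π (0 : Site d L) 0 1 1 1) :=
    wilsonExpectation_wilsonLoopRep_nonneg ρ π hL hρ hβ hπ h10 (h := 1) (by omega) 1
  -- width direction: `W(1,1)^R ≤ W(R,1) = W(1,R)`
  have hwidth : wilsonExpectation ρ β (wilsonLoop π (0 : Site d L) 0 1 1 1) ^ R ≤
      wilsonExpectation ρ β (wilsonLoop π (0 : Site d L) 0 1 1 R) := by
    rw [wilsonExpectation_wilsonLoopRep_swap ρ π hρ hπ β 1 R]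
    exact pow_wilsonExpectation_wilsonLoopRep_le ρ π hL hρ hβ hπ hM h10 hR 1
  -- time direction: `W(1,R)^h ≤ W(h,R)`
  calc wilsonExpectation ρ β (wilsonLoop π (0 : Site d L) 0 1 1 1) ^ (h * R)
      = (wilsonExpectation ρ β (wilsonLoop π (0 : Site d L) 0 1 1 1) ^ R) ^ h := by
        rw [mul_comm, pow_mul]
    _ ≤ wilsonExpectation ρ β (wilsonLoop π (0 : Site d L) 0 1 1 R) ^ h :=
        pow_le_pow_left₀ (pow_nonneg hP R) hwidth h
    _ ≤ wilsonExpectation ρ β (wilsonLoop π (0 : Site d L) 0 1 h R) :=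
        pow_wilsonExpectation_wilsonLoopRep_le ρ π hL hρ hβ hπ hM h10 hh R

end Main

end

end Literature.MathematicalPhysics.QuantumFieldTheory
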